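import Summits.QuantumFields.YangMills.Theses.CoincidenceRotationBootstrap
import Summits.QuantumFields.YangMills.Theorems.CoincidenceRotationBootstrapHypercubicLimitOneFieldWeak
import Summits.QuantumFields.YangMills.Theorems.MirrorModularBoostsHypercubicLimitPeelIdentity
import Summits.QuantumFields.YangMills.Theorems.MirrorModularBoostsHypercubicLimitPeelUniformBound
import Summits.QuantumFields.YangMills.Theorems.PencilRigidityHypercubicLimitDefs
import Summits.QuantumFields.YangMills.Theorems.PencilRigidityHypercubicLimitDefsB
import Summits.QuantumFields.YangMills.Theorems.PencilRigidityHypercubicLimitSoftLegsU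
import HarnessLib

/-!
# Crux `HypercubicLimit` (stmt-QuantumFields-16154) from the inputs of the line `peel-and-disseminate` — the kernel-checked reduction

Support file (`--supports stmt-QuantumFields-16154`, c3 seat) for the crux
`Summit.QuantumFields.YangMills.Theses.CoincidenceRotationBootstrap.HypercubicLimit` (verbatim
`= MirrorModularBoosts.WeakCouplingHypercubicLimit`), line `peel-and-disseminate` (card `Cruxes/HypercubicLimit/Ideas/peel-and-disseminate.md`,
registered skeleton `Cruxes/HypercubicLimit/Lines/peel_and_disseminate.lean`): the tree-side statement that the crux FOLLOWS
from the line's registered inputs, every arrow below being a landed theorem or proved here.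

* `reflectionLegsP_of_pieces` — the host's reflection leg (R) `ReflectionLegsP` (the open registered stub `stub_reflectionLegs`
  of crux stmt-QuantumFields-8646) from its three registered pieces: (R1) hermiticity + RP and (R2) proper-hypercubic invariance
  for every torus demand, (R3) E4 + `HasMassGap 1` supplying the demand (pure logic).
* `lamGaussianDomination_of_peel` — peeling (`stub_peelIdentity`, p125547) + (F′) the blanket product bound + (WI₂)
  `CornerFreeInfluence` ⇒ λ-Gaussian domination of separated centred-plaquette moments, `|∫∏ₖ δpₖ| ≤ (C √A(R'))ⁿ` for
  `λR' ≤ R`-separated plaquettes (the hypothesis of `stub_uniformBoundPeeled`, p126934);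
* `uniformBound_of_peel` — with (W2): the host's (U) `UniformBound`;
* `oneFieldLimitWeak_of_legsP` — (L′) + (S) `SoftLegsP` + (R) `ReflectionLegsP` ⇒ the one-field clauses AT WEAK COUPLING
  (the c1 seat's `oneFieldLimitWeak_of_legs`, p125186, on the `PolyRenorm` interface of `PencilRigidityHypercubicLimitDefsB`);
* `hypercubicLimit_of_peelInputs` — **(F′) → (WI₂) → (W2) → (NG) → (L′) → (R) → the crux BY NAME**, through the landed host
  leg (S) `stub_softLegsU` (p133612) and `hypercubicLimit_iff_oneFieldWeak` (p123041).

So the line is closed modulo: (F′) (its UV bet), (WI₂) (host UV window), (L′)/(W2)/(NG) (host IR sockets), and the three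
provable pieces of (R).  Refs: OsterwalderSchrader1975 §2 (E0′); OsterwalderSeiler1978 §§2–3; GlimmJaffe1987 §6.1, §19;
JaffeWitten2000 §6; Georgii 2011 Rem. 1.24 (Markov property); card `peel-and-disseminate.md`; PICKED-16154-c1.md / -c3.md.
-/

set_option autoImplicit false

noncomputable section

open scoped SchwartzMap ENNReal
open MeasureTheory Filter Topology
open Literature.MathematicalPhysics.AQFT Literature.MathematicalPhysics.QuantumLattice
open Literature.MathematicalPhysics.QuantumFieldTheory
open Literature.Probability.LatticeModels (box Site)
open Summit.QuantumFields.YangMills.Theorems.HypercubicLimit.Negative (torusPlaquette rpSquare influence exterior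
  cubeEdgesT)
open Summit.QuantumFields.YangMills.Cruxes.HypercubicLimit.ConditionalMeanTelescoping
  (GapData LatticeGapInput CornerFreeInfluence WindowRegularity NonGaussianFloor UniformBound SoftData SoftClauses
    ReflClauses PolyRenorm SoftLegsP ReflectionLegsP stub_softLegsU)

namespace Summit.QuantumFields.YangMills.Cruxes.HypercubicLimit.PeelAndDisseminate

/-! ## §1 (R) from its three registered pieces -/

/-- **(R) from its three registered pieces** (pure logic): `ReflectionLegsP` — the SAME statement as the open registered
stub `stub_reflectionLegs` of crux stmt-QuantumFields-8646 — from (R1) hermiticity + RP, (R2) proper-hypercubic invariance,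
(R3) E4 + `HasMassGap 1` (which supplies the torus demand `Λ`). -/
theorem reflectionLegsP_of_pieces
    (h1 : ∀ (G : Type) [Group G] [TopologicalSpace G] [IsTopologicalGroup G] [CompactSpace G]
      [MeasurableSpace G] [BorelSpace G], IsCompactSimpleLieGroup G →
      ∀ (r : LatticeRep G) (β₁ C₁ c₂ : ℝ) (m : ℝ → ℝ), GapData G r β₁ C₁ c₂ m →
        ∀ (Λ : ℝ → ℕ → ℕ) (δ₀ : ℝ) (sch : SpeciesScheme (YMSpecies G)) (S₁ : SchwingerFamily (EuclideanSpace ℝ (Fin 4)))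
          (Spl : (n : ℕ) → (Fin n → Fin 4 × Fin 4) → (𝓢((Fin n → (EuclideanSpace ℝ (Fin 4))), ℂ) →L[ℂ] ℂ)),
          0 < δ₀ → SoftData r m δ₀ Λ sch S₁ Spl → PolyRenorm r sch →
            S₁.toLabelled.IsHermitian ∧ S₁.toLabelled.IsReflectionPositive)
    (h2 : ∀ (G : Type) [Group G] [TopologicalSpace G] [IsTopologicalGroup G] [CompactSpace G]
      [MeasurableSpace G] [BorelSpace G], IsCompactSimpleLieGroup G →
      ∀ (r : LatticeRep G) (β₁ C₁ c₂ : ℝ) (m : ℝ → ℝ), GapData G r β₁ C₁ c₂ m →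
        ∀ (Λ : ℝ → ℕ → ℕ) (δ₀ : ℝ) (sch : SpeciesScheme (YMSpecies G)) (S₁ : SchwingerFamily (EuclideanSpace ℝ (Fin 4)))
          (Spl : (n : ℕ) → (Fin n → Fin 4 × Fin 4) → (𝓢((Fin n → (EuclideanSpace ℝ (Fin 4))), ℂ) →L[ℂ] ℂ)),
          0 < δ₀ → SoftData r m δ₀ Λ sch S₁ Spl → PolyRenorm r sch →
            ∀ (n : ℕ) (k : Fin n → Unit) (R : (EuclideanSpace ℝ (Fin 4)) ≃ₗᵢ[ℝ] (EuclideanSpace ℝ (Fin 4))),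
              LinearMap.det (R.toLinearEquiv : (EuclideanSpace ℝ (Fin 4)) →ₗ[ℝ] (EuclideanSpace ℝ (Fin 4))) = 1 →
              (∀ i : Fin 4, ∃ j : Fin 4, R (EuclideanSpace.single i 1) = EuclideanSpace.single j 1 ∨
                R (EuclideanSpace.single i 1) = -EuclideanSpace.single j 1) →
              ∀ F : 𝓢((Fin n → (EuclideanSpace ℝ (Fin 4))), ℂ), IsOffDiagonal F →
                S₁.toLabelled n k (linActMulti R F) = S₁.toLabelled n k F)
    (h3 : ∀ (G : Type) [Group G] [TopologicalSpace G] [IsTopologicalGroup G] [CompactSpace G]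
      [MeasurableSpace G] [BorelSpace G], IsCompactSimpleLieGroup G →
      ∀ (r : LatticeRep G) (β₁ C₁ c₂ : ℝ) (m : ℝ → ℝ), GapData G r β₁ C₁ c₂ m →
        ∃ Λ : ℝ → ℕ → ℕ, ∀ (δ₀ : ℝ) (sch : SpeciesScheme (YMSpecies G)) (S₁ : SchwingerFamily (EuclideanSpace ℝ (Fin 4)))
          (Spl : (n : ℕ) → (Fin n → Fin 4 × Fin 4) → (𝓢((Fin n → (EuclideanSpace ℝ (Fin 4))), ℂ) →L[ℂ] ℂ)),
          0 < δ₀ → SoftData r m δ₀ Λ sch S₁ Spl → PolyRenorm r sch →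
            S₁.toLabelled.IsHermitian → S₁.toLabelled.IsReflectionPositive →
              S₁.toLabelled.HasClusterProperty ∧ S₁.toLabelled.HasMassGap 1) :
    ReflectionLegsP := by
  intro G _ _ _ _ _ _ hG r β₁ C₁ c₂ m hgap
  obtain ⟨Λ, hΛ⟩ := h3 G hG r β₁ C₁ c₂ m hgap
  refine ⟨Λ, fun δ₀ sch S₁ Spl hδ₀ hD hP => ?_⟩
  obtain ⟨hherm, hRP⟩ := h1 G hG r β₁ C₁ c₂ m hgap Λ δ₀ sch S₁ Spl hδ₀ hD hP
  obtain ⟨hcl, hgap1⟩ := hΛ δ₀ sch S₁ Spl hδ₀ hD hP hherm hRP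
  exact ⟨hherm, hRP, hcl, h2 G hG r β₁ C₁ c₂ m hgap Λ δ₀ sch S₁ Spl hδ₀ hD hP, hgap1⟩

/-! ## §2 Glue, proved: peeling + (F′) + (WI₂) ⇒ λ-Gaussian domination -/

/-- **λ-Gaussian domination of separated moments from peeling** (glue, no sorry of its own): (F′) and (WI₂) give exactly
the domination hypothesis of the landed `stub_uniformBoundPeeled` — for plaquettes pairwise more than `2R+1` apart and a
window radius `R'` with `λR' ≤ R`, `|∫ ∏ₖ δpₖ| ≤ (C √A(R'))ⁿ` with `C = |C_F| · C_W`.  Chain: `stub_peelIdentity` at radius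
`R'` and blow-up `λ` (`|∫∏δp| ≤ ∫∏ E[|Zₖ| | ext Q_{λR'}]`), (F′) (`≤ ∏ |C_F| I₂(R'; xₖ)`), (WI₂) (`I₂ ≤ C_W √A(R')`). -/
theorem lamGaussianDomination_of_peel
    (hF : ∀ (G : Type) [Group G] [TopologicalSpace G] [IsTopologicalGroup G] [CompactSpace G]
      [MeasurableSpace G] [BorelSpace G], IsCompactSimpleLieGroup G →
      ∀ (r : LatticeRep G) (β₁ C₁ c₂ : ℝ) (m : ℝ → ℝ), GapData G r β₁ C₁ c₂ m →
        ∀ c₀ : ℝ, 0 < c₀ → ∃ (lam : ℕ) (C β₀ : ℝ), 1 ≤ lam ∧ ∀ β : ℝ, β₀ ≤ β → ∀ n : ℕ,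
          ∃ S₀ : ℕ, ∀ S : ℕ, S₀ ≤ S →
            ∀ (R : ℕ) (o : Fin n → Fin 4 × Fin 4) (x : Fin n → Site 4),
              (∀ k, (o k).1 ≠ (o k).2) → 1 ≤ R → (R : ℝ) ≤ c₀ / m β → 4 * (lam * R) + 4 < 2 * S + 1 →
              (∀ k l, k ≠ l → ∃ μ : Fin 4, (2 * (lam * R) + 1 : ℤ) < |x k μ - x l μ| ∧ |x k μ - x l μ| ≤ S) →
                ∫ U, ∏ k, ((wilsonMeasure r.ρ β : Measure (GaugeConfig 4 (2 * S + 1) G))[fun U =>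
                    |((wilsonMeasure r.ρ β : Measure (GaugeConfig 4 (2 * S + 1) G))[fun U =>
                        torusPlaquette r (2 * S + 1) (o k).1 (o k).2 (x k) U -
                          ∫ V, torusPlaquette r (2 * S + 1) (o k).1 (o k).2 (x k) V
                            ∂(wilsonMeasure r.ρ β : Measure (GaugeConfig 4 (2 * S + 1) G)) |
                      (exterior (2 * S + 1) R (x k) : MeasurableSpace (GaugeConfig 4 (2 * S + 1) G))]) U| |
                    (exterior (2 * S + 1) (lam * R) (x k) : MeasurableSpace (GaugeConfig 4 (2 * S + 1) G))]) U
                  ∂(wilsonMeasure r.ρ β : Measure (GaugeConfig 4 (2 * S + 1) G)) ≤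
                ∏ k, C * influence r β S R (x k) (o k).1 (o k).2 2)
    (hWI : CornerFreeInfluence) :
    ∀ (G : Type) [Group G] [TopologicalSpace G] [IsTopologicalGroup G] [CompactSpace G]
      [MeasurableSpace G] [BorelSpace G], IsCompactSimpleLieGroup G →
      ∀ (r : LatticeRep G) (β₁ C₁ c₂ : ℝ) (m : ℝ → ℝ), GapData G r β₁ C₁ c₂ m →
        ∀ c₀ : ℝ, 0 < c₀ → ∃ (lam : ℕ) (C β₀ : ℝ), 1 ≤ lam ∧ ∀ β : ℝ, β₀ ≤ β → ∀ n : ℕ, 2 ≤ n →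
          ∃ S₀ : ℕ, ∀ S : ℕ, S₀ ≤ S →
            ∀ (R R' : ℕ) (o : Fin n → Fin 4 × Fin 4) (x : Fin n → Site 4),
              (∀ k, (o k).1 ≠ (o k).2) → 1 ≤ R' → lam * R' ≤ R → (R' : ℝ) ≤ c₀ / m β →
              4 * R + 4 < 2 * S + 1 →
              (∀ k l, k ≠ l → ∃ μ : Fin 4, (2 * R + 1 : ℤ) < |x k μ - x l μ| ∧ |x k μ - x l μ| ≤ S) →
                |∫ U, ∏ k, (torusPlaquette r (2 * S + 1) (o k).1 (o k).2 (x k) U -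
                      ∫ V, torusPlaquette r (2 * S + 1) (o k).1 (o k).2 (x k) V
                        ∂(wilsonMeasure r.ρ β : Measure (GaugeConfig 4 (2 * S + 1) G)))
                    ∂(wilsonMeasure r.ρ β : Measure (GaugeConfig 4 (2 * S + 1) G))| ≤
                  (C * Real.sqrt (rpSquare r β S R')) ^ n := by
  intro G _ _ _ _ _ _ hG r β₁ C₁ c₂ m hgap c₀ hc₀
  obtain ⟨lam, CF, βF, hlam, hF'⟩ := hF G hG r β₁ C₁ c₂ m hgap c₀ hc₀
  obtain ⟨CW, βW, hW'⟩ := hWI G hG r β₁ C₁ c₂ m hgap c₀ hc₀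
  refine ⟨lam, |CF| * CW, max βF βW, hlam, ?_⟩
  intro β hβ n _hn
  have hβF : βF ≤ β := le_trans (le_max_left _ _) hβ
  have hβW : βW ≤ β := le_trans (le_max_right _ _) hβ
  obtain ⟨SF, hSF⟩ := hF' β hβF n
  obtain ⟨SW, hSW⟩ := hW' β hβW
  refine ⟨max SF SW, ?_⟩
  intro S hS R R' o x ho hR'1 hlamR' hR'w hRS hsep
  have hSF' : SF ≤ S := le_trans (le_max_left _ _) hS
  have hSW' : SW ≤ S := le_trans (le_max_right _ _) hS
  -- guards at radius `R'` with blow-up `λ`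
  have hRS' : 4 * (lam * R') + 4 < 2 * S + 1 := by omega
  have hsep' : ∀ k l, k ≠ l →
      ∃ μ : Fin 4, (2 * (lam * R') + 1 : ℤ) < |x k μ - x l μ| ∧ |x k μ - x l μ| ≤ S := by
    intro k l hkl
    obtain ⟨μ, h1, h2⟩ := hsep k l hkl
    refine ⟨μ, lt_of_le_of_lt ?_ h1, h2⟩
    have : ((lam * R' : ℕ) : ℤ) ≤ (R : ℤ) := by exact_mod_cast hlamR'
    push_cast at this ⊢
    linarith
  -- peeling, (F′), (WI₂)
  have hpeel := stub_peelIdentity G r β S lam R' n o x hlam hRS' hsep'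
  have hblanket := hSF S hSF' R' o x ho hR'1 hR'w hRS' hsep'
  have hwin : ∀ k, influence r β S R' (x k) (o k).1 (o k).2 2 ≤ CW * Real.sqrt (rpSquare r β S R') :=
    fun k => hSW S hSW' R' hR'1 hR'w (x k) (o k).1 (o k).2 (ho k)
  have hinfl0 : ∀ k, 0 ≤ influence r β S R' (x k) (o k).1 (o k).2 2 := fun k => by
    unfold influence; exact ENNReal.toReal_nonneg
  calc _ ≤ _ := hpeel
    _ ≤ ∏ k, CF * influence r β S R' (x k) (o k).1 (o k).2 2 := hblanket
    _ = CF ^ n * ∏ k, influence r β S R' (x k) (o k).1 (o k).2 2 := by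
        rw [Finset.prod_mul_distrib, Finset.prod_const, Finset.card_univ, Fintype.card_fin]
    _ ≤ |CF| ^ n * ∏ k, influence r β S R' (x k) (o k).1 (o k).2 2 := by
        refine mul_le_mul_of_nonneg_right ?_ (Finset.prod_nonneg fun k _ => hinfl0 k)
        calc CF ^ n ≤ |CF ^ n| := le_abs_self _
          _ = |CF| ^ n := abs_pow CF n
    _ ≤ |CF| ^ n * ∏ k, (CW * Real.sqrt (rpSquare r β S R')) := by
        refine mul_le_mul_of_nonneg_left ?_ (pow_nonneg (abs_nonneg _) n)
        exact Finset.prod_le_prod (fun k _ => hinfl0 k) fun k _ => hwin k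
    _ = (|CF| * CW * Real.sqrt (rpSquare r β S R')) ^ n := by
        rw [Finset.prod_const, Finset.card_univ, Fintype.card_fin, ← mul_pow, mul_assoc]

/-- **(U) from the line**: (F′) + (WI₂) + (W2) ⇒ the host's `UniformBound` (the landed `stub_uniformBoundPeeled` fed with
`lamGaussianDomination_of_peel`). -/
theorem uniformBound_of_peel
    (hF : ∀ (G : Type) [Group G] [TopologicalSpace G] [IsTopologicalGroup G] [CompactSpace G]
      [MeasurableSpace G] [BorelSpace G], IsCompactSimpleLieGroup G →
      ∀ (r : LatticeRep G) (β₁ C₁ c₂ : ℝ) (m : ℝ → ℝ), GapData G r β₁ C₁ c₂ m →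
        ∀ c₀ : ℝ, 0 < c₀ → ∃ (lam : ℕ) (C β₀ : ℝ), 1 ≤ lam ∧ ∀ β : ℝ, β₀ ≤ β → ∀ n : ℕ,
          ∃ S₀ : ℕ, ∀ S : ℕ, S₀ ≤ S →
            ∀ (R : ℕ) (o : Fin n → Fin 4 × Fin 4) (x : Fin n → Site 4),
              (∀ k, (o k).1 ≠ (o k).2) → 1 ≤ R → (R : ℝ) ≤ c₀ / m β → 4 * (lam * R) + 4 < 2 * S + 1 →
              (∀ k l, k ≠ l → ∃ μ : Fin 4, (2 * (lam * R) + 1 : ℤ) < |x k μ - x l μ| ∧ |x k μ - x l μ| ≤ S) →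
                ∫ U, ∏ k, ((wilsonMeasure r.ρ β : Measure (GaugeConfig 4 (2 * S + 1) G))[fun U =>
                    |((wilsonMeasure r.ρ β : Measure (GaugeConfig 4 (2 * S + 1) G))[fun U =>
                        torusPlaquette r (2 * S + 1) (o k).1 (o k).2 (x k) U -
                          ∫ V, torusPlaquette r (2 * S + 1) (o k).1 (o k).2 (x k) V
                            ∂(wilsonMeasure r.ρ β : Measure (GaugeConfig 4 (2 * S + 1) G)) |
                      (exterior (2 * S + 1) R (x k) : MeasurableSpace (GaugeConfig 4 (2 * S + 1) G))]) U| |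
                    (exterior (2 * S + 1) (lam * R) (x k) : MeasurableSpace (GaugeConfig 4 (2 * S + 1) G))]) U
                  ∂(wilsonMeasure r.ρ β : Measure (GaugeConfig 4 (2 * S + 1) G)) ≤
                ∏ k, C * influence r β S R (x k) (o k).1 (o k).2 2)
    (hWI : CornerFreeInfluence) (hW2 : WindowRegularity) : UniformBound :=
  stub_uniformBoundPeeled (lamGaussianDomination_of_peel hF hWI) hW2

/-! ## §3 Glue, proved: the host closure at weak coupling on the `PolyRenorm` interface -/

/-- **The host closure reassembled at weak coupling, `PolyRenorm` interface** (pure logic): (L′) supplies `r` and the gap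
data, (R) the torus demand `Λ`, (S) the scheme, the one-field family, the renormalisation clause and the soft clauses for
that demand; `SoftData`'s conjunct `Tendsto sch.β atTop atTop` IS `sch.HasWeakCouplingLimit`, and `SoftClauses ∧ ReflClauses`
are the one-field clauses with `Δ = 1`.  (The c1 seat's `oneFieldLimitWeak_of_legs`, p125186, with c1(8646)'s clause threaded.) -/
theorem oneFieldLimitWeak_of_legsP : LatticeGapInput → SoftLegsP → ReflectionLegsP →
    ∀ (G : Type) [Group G] [TopologicalSpace G] [IsTopologicalGroup G] [CompactSpace G] [MeasurableSpace G]
      [BorelSpace G], IsCompactSimpleLieGroup G →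
        ∃ (r : LatticeRep G) (sch : SpeciesScheme (YMSpecies G)) (S₁ : SchwingerFamily (EuclideanSpace ℝ (Fin 4))),
          sch.HasWeakCouplingLimit ∧ ((S₁.toLabelled.IsNormalized ∧ S₁.toLabelled.IsHermitian ∧
            S₁.toLabelled.HasLinearGrowth ∧
          S₁.toLabelled.IsReflectionPositive ∧ S₁.toLabelled.IsSymmetric ∧ S₁.toLabelled.HasClusterProperty ∧
          (∀ (n : ℕ) (k : Fin n → Unit) (a : EuclideanSpace ℝ (Fin 4)) (F : 𝓢((Fin n → EuclideanSpace ℝ (Fin 4)), ℂ)),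
            IsOffDiagonal F → S₁.toLabelled n k (translateMulti a F) = S₁.toLabelled n k F) ∧
          (∀ (n : ℕ) (k : Fin n → Unit) (R : EuclideanSpace ℝ (Fin 4) ≃ₗᵢ[ℝ] EuclideanSpace ℝ (Fin 4)),
            LinearMap.det (R.toLinearEquiv : EuclideanSpace ℝ (Fin 4) →ₗ[ℝ] EuclideanSpace ℝ (Fin 4)) = 1 →
            (∀ i : Fin 4, ∃ j : Fin 4, R (EuclideanSpace.single i 1) = EuclideanSpace.single j 1 ∨
              R (EuclideanSpace.single i 1) = -EuclideanSpace.single j 1) →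
            ∀ F : 𝓢((Fin n → EuclideanSpace ℝ (Fin 4)), ℂ), IsOffDiagonal F →
              S₁.toLabelled n k (linActMulti R F) = S₁.toLabelled n k F)) ∧
        (∀ (n : ℕ), n ≠ 0 → ∀ (f : Fin n → 𝓢(EuclideanSpace ℝ (Fin 4), ℝ))
            (F : 𝓢((Fin n → EuclideanSpace ℝ (Fin 4)), ℂ)),
          IsTensorOf F (fun i => ofRealTest (f i)) → IsOffDiagonal F →
            Tendsto (fun k : ℕ =>
              ((latticeSchwinger r.ρ sch (fun s => s.F) k n (fun _ => r.curvature) f : ℝ) : ℂ))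
              atTop (𝓝 (S₁ n F))) ∧
        (∃ (F₁ G₁ : 𝓢((Fin 1 → EuclideanSpace ℝ (Fin 4)), ℂ)) (H₁ : 𝓢((Fin (1 + 1) → EuclideanSpace ℝ (Fin 4)), ℂ)),
          IsTimeOrdered F₁ ∧ IsTimeOrdered G₁ ∧ IsAppendTensorOf H₁ (osAdjoint F₁) G₁ ∧
            S₁.toLabelled (1 + 1) (fun _ => ()) H₁ ≠
              S₁.toLabelled 1 (fun _ => ()) (osAdjoint F₁) * S₁.toLabelled 1 (fun _ => ()) G₁) ∧
        (∃ (f g h : 𝓢(EuclideanSpace ℝ (Fin 4), ℂ)) (Ffgh : 𝓢((Fin 3 → EuclideanSpace ℝ (Fin 4)), ℂ))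
            (Fgh Ffh Ffg : 𝓢((Fin 2 → EuclideanSpace ℝ (Fin 4)), ℂ))
            (Ff Fg Fh : 𝓢((Fin 1 → EuclideanSpace ℝ (Fin 4)), ℂ)),
          IsTensorOf Ffgh ![f, g, h] ∧ IsOffDiagonal Ffgh ∧ IsTensorOf Fgh ![g, h] ∧ IsTensorOf Ffh ![f, h] ∧
          IsTensorOf Ffg ![f, g] ∧ IsTensorOf Ff ![f] ∧ IsTensorOf Fg ![g] ∧ IsTensorOf Fh ![h] ∧
            S₁.toLabelled 3 (fun _ => ()) Ffgh - S₁.toLabelled 1 (fun _ => ()) Ff * S₁.toLabelled 2 (fun _ => ()) Fgh -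
              S₁.toLabelled 1 (fun _ => ()) Fg * S₁.toLabelled 2 (fun _ => ()) Ffh -
              S₁.toLabelled 1 (fun _ => ()) Fh * S₁.toLabelled 2 (fun _ => ()) Ffg +
              2 * (S₁.toLabelled 1 (fun _ => ()) Ff * S₁.toLabelled 1 (fun _ => ()) Fg *
                S₁.toLabelled 1 (fun _ => ()) Fh) ≠ 0) ∧
        (∃ Δ : ℝ, 0 < Δ ∧ S₁.toLabelled.HasMassGap Δ ∧ HasLatticeMassGap r sch Δ)) := by
  intro hL hS hR G _ _ _ _ _ _ hG
  obtain ⟨r, β₁, C₁, c₂, m, hgap⟩ := hL G hG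
  obtain ⟨Λ, hΛ⟩ := hR G hG r β₁ C₁ c₂ m hgap
  obtain ⟨δ₀, sch, S₁, Spl, hδ₀, hD, hP, hE0, hE0', hE3, htr, hconv, hNT, hNG, hlat⟩ := hS G hG r β₁ C₁ c₂ m hgap Λ
  obtain ⟨hherm, hRP, hcl, hhyp, hgap1⟩ := hΛ δ₀ sch S₁ Spl hδ₀ hD hP
  exact ⟨r, sch, S₁, hD.2.1, ⟨hE0, hherm, hE0', hRP, hE3, hcl, htr, hhyp⟩, hconv, by simpa using hNT,
    by simpa using hNG, 1, one_pos, hgap1, hlat⟩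

/-! ## §4 The composition: the crux BY NAME -/

/-- **Registered sub-goal `hypercubicLimit_of_peelInputs` — the crux `HypercubicLimit` BY NAME from the line's inputs.**
The whole line `peel-and-disseminate` in one implication: (F′) the blanket product bound, (WI₂) `CornerFreeInfluence`,
(W2) `WindowRegularity`, (NG) `NonGaussianFloor`, (L′) `LatticeGapInput`, (R) `ReflectionLegsP` ⇒ the shared
existence-minus-rotations leg of `YangMills` (`uniformBound_of_peel` ⇒ landed host leg (S) `stub_softLegsU` = `SoftLegsP` ⇒
`oneFieldLimitWeak_of_legsP` ⇒ landed `hypercubicLimit_iff_oneFieldWeak`). [folklore] -/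
theorem hypercubicLimit_of_peelInputs :
    (∀ (G : Type) [Group G] [TopologicalSpace G] [IsTopologicalGroup G] [CompactSpace G]
      [MeasurableSpace G] [BorelSpace G], IsCompactSimpleLieGroup G →
      ∀ (r : LatticeRep G) (β₁ C₁ c₂ : ℝ) (m : ℝ → ℝ), GapData G r β₁ C₁ c₂ m →
        ∀ c₀ : ℝ, 0 < c₀ → ∃ (lam : ℕ) (C β₀ : ℝ), 1 ≤ lam ∧ ∀ β : ℝ, β₀ ≤ β → ∀ n : ℕ,
          ∃ S₀ : ℕ, ∀ S : ℕ, S₀ ≤ S →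
            ∀ (R : ℕ) (o : Fin n → Fin 4 × Fin 4) (x : Fin n → Site 4),
              (∀ k, (o k).1 ≠ (o k).2) → 1 ≤ R → (R : ℝ) ≤ c₀ / m β → 4 * (lam * R) + 4 < 2 * S + 1 →
              (∀ k l, k ≠ l → ∃ μ : Fin 4, (2 * (lam * R) + 1 : ℤ) < |x k μ - x l μ| ∧ |x k μ - x l μ| ≤ S) →
                ∫ U, ∏ k, ((wilsonMeasure r.ρ β : Measure (GaugeConfig 4 (2 * S + 1) G))[fun U =>
                    |((wilsonMeasure r.ρ β : Measure (GaugeConfig 4 (2 * S + 1) G))[fun U =>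
                        torusPlaquette r (2 * S + 1) (o k).1 (o k).2 (x k) U -
                          ∫ V, torusPlaquette r (2 * S + 1) (o k).1 (o k).2 (x k) V
                            ∂(wilsonMeasure r.ρ β : Measure (GaugeConfig 4 (2 * S + 1) G)) |
                      (exterior (2 * S + 1) R (x k) : MeasurableSpace (GaugeConfig 4 (2 * S + 1) G))]) U| |
                    (exterior (2 * S + 1) (lam * R) (x k) : MeasurableSpace (GaugeConfig 4 (2 * S + 1) G))]) U
                  ∂(wilsonMeasure r.ρ β : Measure (GaugeConfig 4 (2 * S + 1) G)) ≤
                ∏ k, C * influence r β S R (x k) (o k).1 (o k).2 2) →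
    CornerFreeInfluence → WindowRegularity → NonGaussianFloor → LatticeGapInput → ReflectionLegsP →
      Summit.QuantumFields.YangMills.Theses.CoincidenceRotationBootstrap.HypercubicLimit := by
  intro hF hWI hW2 hNG hL hR
  have hU : UniformBound := uniformBound_of_peel hF hWI hW2
  have hS : SoftLegsP := stub_softLegsU hU hW2 hNG
  refine Summit.QuantumFields.YangMills.Theorems.HypercubicLimit.OneFieldWeak.hypercubicLimit_iff_oneFieldWeak.mpr
    fun G _ _ _ _ hG => ?_
  letI : MeasurableSpace G := borel G
  haveI : BorelSpace G := ⟨rfl⟩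
  exact oneFieldLimitWeak_of_legsP hL hS hR G hG

end Summit.QuantumFields.YangMills.Cruxes.HypercubicLimit.PeelAndDisseminate

end
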